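import Summits.CriticalPhenomena.Ising3DConformalLimit.Theorems.EnergyNotSigmaSquaredRungOneAdjacentMergingDefs

/-!
# Load-bearing hypotheses of the abstract share harvest `AbstractHarvest`
# (stub `stub_abstractHarvest` of the line `dominant-shell-concentration`, crux `RungOneAdjacentMerging`,
# item stmt-CriticalPhenomena-11262) — refuter evidence (drefute)

`AbstractHarvest` (defined in `…Theorems.EnergyNotSigmaSquaredRungOneAdjacentMergingDefs`) says: for all real
sequences `a, B` with `HarvestData a B` (nine fields: `a > 0` antitone `→ 0`, dyadic log-convexity,
`B 0 > 0`, `B` monotone `→ ∞`, and the shell sandwich `7·8^k a(k+2)² ≤ B k - B (k-1) ≤ 19·8^k a(k-1)²`),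
there are windowed, `τ`-decay-separated finite scale families with `Σ 8^k a(k+2)²/B(k+1)` as large as
desired.  This file records, as theorems:

* `harvestData_model` — the hypothesis `HarvestData` is satisfiable (`a j = 2⁻ʲ`, `B k = 2^{k+1}`), so the
  stub is not vacuous;
* `abstractHarvest_false_without_decay` — with the field `a_tendsto` (`a → 0`) deleted the statement is
  FALSE (witness `a ≡ 1`, `B k = 8^{k+1}`: no two scales are `τ`-separated for `τ < 1`, one scale carries
  share `1/64`);
* `abstractHarvest_false_without_shellUpper` — with the field `shell_upper` deleted it is FALSE (witness
  `a j = 2⁻ʲ`, `B k = 8^{k+1}`: the shares `4⁻ᵏ/1024` are summable);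
* `abstractHarvest_false_without_bubbleDivergence` — with the field `B_tendsto` (`B → ∞`, the `d = 3`
  input `B(β_c) = ∞`) deleted it is FALSE (witness `a j = 4⁻ʲ`, `B k = 2 - 2⁻ᵏ`: shares `≤ 2⁻ᵏ/256`).

So any proof of `stub_abstractHarvest` must use `a_tendsto`, `shell_upper` and `B_tendsto`.
-/

noncomputable section

open Filter Finset
open scoped BigOperators

namespace Summit.CriticalPhenomena.Ising3DConformalLimit.RungOneAdjacentMergingDominantShell

/-- The conclusion of `AbstractHarvest` for one pair of sequences `a, B`. [folklore] -/
def HarvestConclusion (a B : ℕ → ℝ) : Prop :=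
  ∃ A : ℝ, 1 ≤ A ∧ ∀ τ : ℝ, 0 < τ → ∀ (k₀ : ℕ) (M : ℝ), ∃ 𝒦 : Finset ℕ,
    (∀ k ∈ 𝒦, k₀ ≤ k ∧ a (k - 4) ≤ A * a (k + 4)) ∧
    (∀ k ∈ 𝒦, ∀ ℓ ∈ 𝒦, k < ℓ → a (ℓ - 2) ≤ τ * a (k + 2) ∧ (2 : ℝ) ^ (k + 1) ≤ τ * 2 ^ ℓ) ∧
    M ≤ ∑ k ∈ 𝒦, (8 : ℝ) ^ k * a (k + 2) ^ 2 / B (k + 1)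

/-- `AbstractHarvest` is `HarvestData → HarvestConclusion`, pointwise (definitional). [folklore] -/
theorem abstractHarvest_iff :
    AbstractHarvest ↔ ∀ a B : ℕ → ℝ, HarvestData a B → HarvestConclusion a B :=
  Iff.rfl

/-! ### Non-vacuity: a model of `HarvestData` -/

/-- `HarvestData` is satisfiable: `a j = 2⁻ʲ`, `B k = 2^{k+1}`. [folklore] -/
theorem harvestData_model : HarvestData (fun j => (1 / 2 : ℝ) ^ j) (fun k => (2 : ℝ) ^ (k + 1)) where
  a_pos := fun j => by positivity
  a_anti := fun m n h => pow_le_pow_of_le_one (by norm_num) (by norm_num) h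
  a_tendsto := tendsto_pow_atTop_nhds_zero_of_lt_one (by norm_num) (by norm_num)
  a_logConvex := fun j => by
    rw [← pow_mul, ← pow_mul, ← pow_add]
    exact pow_le_pow_of_le_one (by norm_num) (by norm_num) (by omega)
  B_pos := by norm_num
  B_mono := fun m n h => pow_le_pow_right₀ (by norm_num) (by omega)
  B_tendsto := (tendsto_pow_atTop_atTop_of_one_lt (by norm_num : (1 : ℝ) < 2)).comp (tendsto_add_atTop_nat 1)
  shell_lower := fun k hk => by
    obtain ⟨m, rfl⟩ : ∃ m, k = m + 1 := ⟨k - 1, by omega⟩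
    simp only [Nat.add_sub_cancel]
    have h84 : (8 : ℝ) ^ m = 4 ^ m * 2 ^ m := by rw [← mul_pow]; norm_num
    have ha : ((1 / 2 : ℝ) ^ (m + 1 + 2)) ^ 2 = (1 / 4) ^ m / 64 := by
      rw [pow_right_comm, show ((1 / 2 : ℝ)) ^ 2 = 1 / 4 by norm_num]; ring
    have h41 : (4 : ℝ) ^ m * (1 / 4) ^ m = 1 := by rw [← mul_pow]; norm_num
    have hL : 7 * 8 ^ (m + 1) * ((1 / 2 : ℝ) ^ (m + 1 + 2)) ^ 2 = 7 / 8 * 2 ^ m := by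
      rw [ha, pow_succ, h84]
      linear_combination (7 / 8 * (2 : ℝ) ^ m) * h41
    have hR : (2 : ℝ) ^ (m + 1 + 1) - 2 ^ (m + 1) = 2 * 2 ^ m := by ring
    rw [hL, hR]
    have h2 : (0 : ℝ) < 2 ^ m := by positivity
    linarith
  shell_upper := fun k hk => by
    obtain ⟨m, rfl⟩ : ∃ m, k = m + 1 := ⟨k - 1, by omega⟩
    simp only [Nat.add_sub_cancel]
    have h84 : (8 : ℝ) ^ m = 4 ^ m * 2 ^ m := by rw [← mul_pow]; norm_num
    have ha : ((1 / 2 : ℝ) ^ m) ^ 2 = (1 / 4) ^ m := by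
      rw [pow_right_comm, show ((1 / 2 : ℝ)) ^ 2 = 1 / 4 by norm_num]
    have h41 : (4 : ℝ) ^ m * (1 / 4) ^ m = 1 := by rw [← mul_pow]; norm_num
    have hU : 19 * 8 ^ (m + 1) * ((1 / 2 : ℝ) ^ m) ^ 2 = 152 * 2 ^ m := by
      rw [ha, pow_succ, h84]
      linear_combination (152 * (2 : ℝ) ^ m) * h41
    have hR : (2 : ℝ) ^ (m + 1 + 1) - 2 ^ (m + 1) = 2 * 2 ^ m := by ring
    rw [hU, hR]
    have h2 : (0 : ℝ) < 2 ^ m := by positivity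
    linarith

/-! ### `a → 0` is load-bearing -/

/-- `HarvestData` with the decay field `a_tendsto : Tendsto a atTop (nhds 0)` deleted. [folklore] -/
structure HarvestDataWithoutDecay (a B : ℕ → ℝ) : Prop where
  a_pos : ∀ j, 0 < a j
  a_anti : Antitone a
  a_logConvex : ∀ j, a (j + 1) ^ 3 ≤ a j ^ 2 * a (j + 2)
  B_pos : 0 < B 0
  B_mono : Monotone B
  B_tendsto : Tendsto B atTop atTop
  shell_lower : ∀ k, 1 ≤ k → 7 * 8 ^ k * a (k + 2) ^ 2 ≤ B k - B (k - 1)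
  shell_upper : ∀ k, 1 ≤ k → B k - B (k - 1) ≤ 19 * 8 ^ k * a (k - 1) ^ 2

/-- `HarvestData` is exactly `HarvestDataWithoutDecay` plus `a → 0`. [folklore] -/
theorem harvestData_iff_withoutDecay (a B : ℕ → ℝ) :
    HarvestData a B ↔ HarvestDataWithoutDecay a B ∧ Tendsto a atTop (nhds 0) :=
  ⟨fun h => ⟨⟨h.a_pos, h.a_anti, h.a_logConvex, h.B_pos, h.B_mono, h.B_tendsto, h.shell_lower, h.shell_upper⟩,
      h.a_tendsto⟩,
    fun ⟨h, ht⟩ => ⟨h.a_pos, h.a_anti, ht, h.a_logConvex, h.B_pos, h.B_mono, h.B_tendsto, h.shell_lower,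
      h.shell_upper⟩⟩

/-- **`a → 0` is load-bearing**: with `a ≡ 1`, `B k = 8^{k+1}` every other field of `HarvestData` holds,
but for `τ = 1/2` no two scales are decay-separated (`a(ℓ-2) ≤ τ·a(k+2)` reads `1 ≤ 1/2`), so an admissible
family has at most one scale and share sum `≤ 1/64 < 1`. [folklore] -/
theorem abstractHarvest_false_without_decay :
    ¬ (∀ a B : ℕ → ℝ, HarvestDataWithoutDecay a B → HarvestConclusion a B) := by
  intro h
  have hD : HarvestDataWithoutDecay (fun _ => (1 : ℝ)) (fun k => (8 : ℝ) ^ (k + 1)) :=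
    { a_pos := fun _ => one_pos
      a_anti := fun _ _ _ => le_rfl
      a_logConvex := fun _ => by norm_num
      B_pos := by norm_num
      B_mono := fun m n hmn => pow_le_pow_right₀ (by norm_num) (by omega)
      B_tendsto := (tendsto_pow_atTop_atTop_of_one_lt (by norm_num : (1 : ℝ) < 8)).comp
        (tendsto_add_atTop_nat 1)
      shell_lower := fun k hk => by
        obtain ⟨m, rfl⟩ : ∃ m, k = m + 1 := ⟨k - 1, by omega⟩
        simp only [Nat.add_sub_cancel]
        have h8 : (0 : ℝ) < 8 ^ m := by positivity
        have e1 : (8 : ℝ) ^ (m + 1) = 8 * 8 ^ m := by ring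
        have e2 : (8 : ℝ) ^ (m + 1 + 1) = 64 * 8 ^ m := by ring
        rw [e1, e2]; nlinarith
      shell_upper := fun k hk => by
        obtain ⟨m, rfl⟩ : ∃ m, k = m + 1 := ⟨k - 1, by omega⟩
        simp only [Nat.add_sub_cancel]
        have h8 : (0 : ℝ) < 8 ^ m := by positivity
        have e1 : (8 : ℝ) ^ (m + 1) = 8 * 8 ^ m := by ring
        have e2 : (8 : ℝ) ^ (m + 1 + 1) = 64 * 8 ^ m := by ring
        rw [e1, e2]; nlinarith }
  obtain ⟨A, -, hcon⟩ := h _ _ hD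
  obtain ⟨𝒦, -, hsep, hM⟩ := hcon (1 / 2) (by norm_num) 0 1
  dsimp only at hM hsep
  -- at most one scale survives the separation constraint
  have hone : ∀ k ∈ 𝒦, ∀ ℓ ∈ 𝒦, k = ℓ := by
    intro k hk ℓ hℓ
    by_contra hne
    rcases lt_or_gt_of_ne hne with hlt | hlt
    · have := (hsep k hk ℓ hℓ hlt).1; norm_num at this
    · have := (hsep ℓ hℓ k hk hlt).1; norm_num at this
  have hcard : (𝒦.card : ℝ) ≤ 1 := by exact_mod_cast Finset.card_le_one.2 hone
  have hterm : ∀ k : ℕ, (8 : ℝ) ^ k * (1 : ℝ) ^ 2 / 8 ^ (k + 1 + 1) = 1 / 64 := by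
    intro k
    have h8 : (8 : ℝ) ^ k ≠ 0 := by positivity
    rw [one_pow, mul_one, pow_succ, pow_succ]
    field_simp
    ring
  simp_rw [hterm] at hM
  rw [Finset.sum_const, nsmul_eq_mul] at hM
  linarith

/-! ### The upper shell bound is load-bearing -/

/-- `HarvestData` with the field `shell_upper` deleted. [folklore] -/
structure HarvestDataWithoutShellUpper (a B : ℕ → ℝ) : Prop where
  a_pos : ∀ j, 0 < a j
  a_anti : Antitone a
  a_tendsto : Tendsto a atTop (nhds 0)
  a_logConvex : ∀ j, a (j + 1) ^ 3 ≤ a j ^ 2 * a (j + 2)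
  B_pos : 0 < B 0
  B_mono : Monotone B
  B_tendsto : Tendsto B atTop atTop
  shell_lower : ∀ k, 1 ≤ k → 7 * 8 ^ k * a (k + 2) ^ 2 ≤ B k - B (k - 1)

/-- `HarvestData` is exactly `HarvestDataWithoutShellUpper` plus `shell_upper`. [folklore] -/
theorem harvestData_iff_withoutShellUpper (a B : ℕ → ℝ) :
    HarvestData a B ↔ HarvestDataWithoutShellUpper a B ∧
      ∀ k, 1 ≤ k → B k - B (k - 1) ≤ 19 * 8 ^ k * a (k - 1) ^ 2 :=
  ⟨fun h => ⟨⟨h.a_pos, h.a_anti, h.a_tendsto, h.a_logConvex, h.B_pos, h.B_mono, h.B_tendsto, h.shell_lower⟩,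
      h.shell_upper⟩,
    fun ⟨h, hu⟩ => ⟨h.a_pos, h.a_anti, h.a_tendsto, h.a_logConvex, h.B_pos, h.B_mono, h.B_tendsto,
      h.shell_lower, hu⟩⟩

/-- **`shell_upper` is load-bearing**: with `a j = 2⁻ʲ`, `B k = 8^{k+1}` (a bubble growing much faster
than the shells allow) every other field holds, but the shares are `4⁻ᵏ/1024`, summable with total
`≤ 1/768 < 1`. [folklore] -/
theorem abstractHarvest_false_without_shellUpper :
    ¬ (∀ a B : ℕ → ℝ, HarvestDataWithoutShellUpper a B → HarvestConclusion a B) := by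
  intro h
  have hD : HarvestDataWithoutShellUpper (fun j => (1 / 2 : ℝ) ^ j) (fun k => (8 : ℝ) ^ (k + 1)) :=
    { a_pos := fun j => by positivity
      a_anti := fun m n hmn => pow_le_pow_of_le_one (by norm_num) (by norm_num) hmn
      a_tendsto := tendsto_pow_atTop_nhds_zero_of_lt_one (by norm_num) (by norm_num)
      a_logConvex := fun j => by
        rw [← pow_mul, ← pow_mul, ← pow_add]
        exact pow_le_pow_of_le_one (by norm_num) (by norm_num) (by omega)
      B_pos := by norm_num
      B_mono := fun m n hmn => pow_le_pow_right₀ (by norm_num) (by omega)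
      B_tendsto := (tendsto_pow_atTop_atTop_of_one_lt (by norm_num : (1 : ℝ) < 8)).comp
        (tendsto_add_atTop_nat 1)
      shell_lower := fun k hk => by
        obtain ⟨m, rfl⟩ : ∃ m, k = m + 1 := ⟨k - 1, by omega⟩
        simp only [Nat.add_sub_cancel]
        have h8 : (0 : ℝ) < 8 ^ m := by positivity
        have hle : ((1 / 2 : ℝ) ^ (m + 1 + 2)) ^ 2 ≤ 1 :=
          pow_le_one₀ (by positivity) (pow_le_one₀ (by norm_num) (by norm_num))
        have h0 : (0 : ℝ) ≤ ((1 / 2 : ℝ) ^ (m + 1 + 2)) ^ 2 := by positivity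
        have e1 : (8 : ℝ) ^ (m + 1) = 8 * 8 ^ m := by ring
        have e2 : (8 : ℝ) ^ (m + 1 + 1) = 64 * 8 ^ m := by ring
        rw [e1, e2]; nlinarith }
  obtain ⟨A, -, hcon⟩ := h _ _ hD
  obtain ⟨𝒦, -, -, hM⟩ := hcon (1 / 2) (by norm_num) 0 1
  dsimp only at hM
  have hterm : ∀ k : ℕ, (8 : ℝ) ^ k * ((1 / 2 : ℝ) ^ (k + 2)) ^ 2 / 8 ^ (k + 1 + 1) = (1 / 4) ^ k / 1024 := by
    intro k
    have h8 : (8 : ℝ) ^ k ≠ 0 := by positivity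
    have ha : ((1 / 2 : ℝ) ^ (k + 2)) ^ 2 = (1 / 4) ^ k / 16 := by
      rw [pow_right_comm, show ((1 / 2 : ℝ)) ^ 2 = 1 / 4 by norm_num]; ring
    rw [ha, pow_succ, pow_succ]
    field_simp
    ring
  simp_rw [hterm] at hM
  rw [← Finset.sum_div] at hM
  have hgeo : ∑ k ∈ 𝒦, (1 / 4 : ℝ) ^ k ≤ ∑' k, (1 / 4 : ℝ) ^ k :=
    (summable_geometric_of_lt_one (by norm_num) (by norm_num)).sum_le_tsum 𝒦 (fun k _ => by positivity)
  rw [tsum_geometric_of_lt_one (by norm_num) (by norm_num)] at hgeo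
  norm_num at hgeo
  have : (∑ k ∈ 𝒦, (1 / 4 : ℝ) ^ k) / 1024 ≤ (4 / 3) / 1024 := by gcongr
  linarith

/-! ### Bubble divergence `B → ∞` is load-bearing -/

/-- `HarvestData` with the field `B_tendsto : Tendsto B atTop atTop` deleted. [folklore] -/
structure HarvestDataWithoutBubbleDivergence (a B : ℕ → ℝ) : Prop where
  a_pos : ∀ j, 0 < a j
  a_anti : Antitone a
  a_tendsto : Tendsto a atTop (nhds 0)
  a_logConvex : ∀ j, a (j + 1) ^ 3 ≤ a j ^ 2 * a (j + 2)
  B_pos : 0 < B 0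
  B_mono : Monotone B
  shell_lower : ∀ k, 1 ≤ k → 7 * 8 ^ k * a (k + 2) ^ 2 ≤ B k - B (k - 1)
  shell_upper : ∀ k, 1 ≤ k → B k - B (k - 1) ≤ 19 * 8 ^ k * a (k - 1) ^ 2

/-- `HarvestData` is exactly `HarvestDataWithoutBubbleDivergence` plus `B → ∞`. [folklore] -/
theorem harvestData_iff_withoutBubbleDivergence (a B : ℕ → ℝ) :
    HarvestData a B ↔ HarvestDataWithoutBubbleDivergence a B ∧ Tendsto B atTop atTop :=
  ⟨fun h => ⟨⟨h.a_pos, h.a_anti, h.a_tendsto, h.a_logConvex, h.B_pos, h.B_mono, h.shell_lower, h.shell_upper⟩,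
      h.B_tendsto⟩,
    fun ⟨h, ht⟩ => ⟨h.a_pos, h.a_anti, h.a_tendsto, h.a_logConvex, h.B_pos, h.B_mono, ht, h.shell_lower,
      h.shell_upper⟩⟩

/-- **`B → ∞` is load-bearing** (the abstract shadow of "finite bubble ⇒ no harvest", as in `d ≥ 5`):
with `a j = 4⁻ʲ` and the bounded bubble `B k = 2 - 2⁻ᵏ` every other field holds, but the shares are
`≤ 2⁻ᵏ/256`, with total `≤ 1/128 < 1`. [folklore] -/
theorem abstractHarvest_false_without_bubbleDivergence :
    ¬ (∀ a B : ℕ → ℝ, HarvestDataWithoutBubbleDivergence a B → HarvestConclusion a B) := by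
  intro h
  have hD : HarvestDataWithoutBubbleDivergence (fun j => (1 / 4 : ℝ) ^ j) (fun k => 2 - (1 / 2 : ℝ) ^ k) :=
    { a_pos := fun j => by positivity
      a_anti := fun m n hmn => pow_le_pow_of_le_one (by norm_num) (by norm_num) hmn
      a_tendsto := tendsto_pow_atTop_nhds_zero_of_lt_one (by norm_num) (by norm_num)
      a_logConvex := fun j => by
        rw [← pow_mul, ← pow_mul, ← pow_add]
        exact pow_le_pow_of_le_one (by norm_num) (by norm_num) (by omega)
      B_pos := by norm_num
      B_mono := fun m n hmn => by
        have := pow_le_pow_of_le_one (by norm_num : (0 : ℝ) ≤ 1 / 2) (by norm_num) hmn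
        dsimp only; linarith
      shell_lower := fun k hk => by
        obtain ⟨m, rfl⟩ : ∃ m, k = m + 1 := ⟨k - 1, by omega⟩
        simp only [Nat.add_sub_cancel]
        have key : (8 : ℝ) ^ m * (1 / 16 : ℝ) ^ m = (1 / 2) ^ m := by rw [← mul_pow]; norm_num
        have ha : ((1 / 4 : ℝ) ^ (m + 1 + 2)) ^ 2 = (1 / 16) ^ m / 4096 := by
          rw [pow_right_comm, show ((1 / 4 : ℝ)) ^ 2 = 1 / 16 by norm_num]; ring
        have hL : 7 * 8 ^ (m + 1) * ((1 / 4 : ℝ) ^ (m + 1 + 2)) ^ 2 = 7 / 512 * (1 / 2) ^ m := by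
          rw [ha, pow_succ, ← key]; ring
        have hR : (2 - (1 / 2 : ℝ) ^ (m + 1)) - (2 - (1 / 2) ^ m) = 1 / 2 * (1 / 2) ^ m := by ring
        rw [hL, hR]
        have h2 : (0 : ℝ) < (1 / 2) ^ m := by positivity
        linarith
      shell_upper := fun k hk => by
        obtain ⟨m, rfl⟩ : ∃ m, k = m + 1 := ⟨k - 1, by omega⟩
        simp only [Nat.add_sub_cancel]
        have key : (8 : ℝ) ^ m * (1 / 16 : ℝ) ^ m = (1 / 2) ^ m := by rw [← mul_pow]; norm_num
        have ha : ((1 / 4 : ℝ) ^ m) ^ 2 = (1 / 16) ^ m := by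
          rw [pow_right_comm, show ((1 / 4 : ℝ)) ^ 2 = 1 / 16 by norm_num]
        have hU : 19 * 8 ^ (m + 1) * ((1 / 4 : ℝ) ^ m) ^ 2 = 152 * (1 / 2) ^ m := by
          rw [ha, pow_succ, ← key]; ring
        have hR : (2 - (1 / 2 : ℝ) ^ (m + 1)) - (2 - (1 / 2) ^ m) = 1 / 2 * (1 / 2) ^ m := by ring
        rw [hU, hR]
        have h2 : (0 : ℝ) < (1 / 2) ^ m := by positivity
        linarith }
  obtain ⟨A, -, hcon⟩ := h _ _ hD
  obtain ⟨𝒦, -, -, hM⟩ := hcon (1 / 2) (by norm_num) 0 1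
  dsimp only at hM
  have hterm : ∀ k : ℕ,
      (8 : ℝ) ^ k * ((1 / 4 : ℝ) ^ (k + 2)) ^ 2 / (2 - (1 / 2 : ℝ) ^ (k + 1)) ≤ (1 / 2) ^ k / 256 := by
    intro k
    have key : (8 : ℝ) ^ k * (1 / 16 : ℝ) ^ k = (1 / 2) ^ k := by rw [← mul_pow]; norm_num
    have ha : ((1 / 4 : ℝ) ^ (k + 2)) ^ 2 = (1 / 16) ^ k / 256 := by
      rw [pow_right_comm, show ((1 / 4 : ℝ)) ^ 2 = 1 / 16 by norm_num]; ring
    have hnum : (8 : ℝ) ^ k * ((1 / 4 : ℝ) ^ (k + 2)) ^ 2 = (1 / 2) ^ k / 256 := by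
      rw [ha, ← key]; ring
    have hden : (1 : ℝ) ≤ 2 - (1 / 2 : ℝ) ^ (k + 1) := by
      have := pow_le_one₀ (n := k + 1) (by norm_num : (0 : ℝ) ≤ 1 / 2) (by norm_num)
      linarith
    rw [hnum]
    exact div_le_self (by positivity) hden
  have hsum : ∑ k ∈ 𝒦, (8 : ℝ) ^ k * ((1 / 4 : ℝ) ^ (k + 2)) ^ 2 / (2 - (1 / 2 : ℝ) ^ (k + 1)) ≤
      ∑ k ∈ 𝒦, (1 / 2 : ℝ) ^ k / 256 := Finset.sum_le_sum fun k _ => hterm k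
  rw [← Finset.sum_div] at hsum
  have hgeo : ∑ k ∈ 𝒦, (1 / 2 : ℝ) ^ k ≤ ∑' k, (1 / 2 : ℝ) ^ k :=
    summable_geometric_two.sum_le_tsum 𝒦 (fun k _ => by positivity)
  rw [tsum_geometric_two] at hgeo
  have : (∑ k ∈ 𝒦, (1 / 2 : ℝ) ^ k) / 256 ≤ 2 / 256 := by gcongr
  linarith

end Summit.CriticalPhenomena.Ising3DConformalLimit.RungOneAdjacentMergingDominantShell

end
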